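import Summits.HodgeConjecture.CorCM.Census.QuarticInversionNormalForm
import Summits.HodgeConjecture.CorCM.Census.QuarticInversionClosingS

/-!
# The quartic inversion twists, XXI: the blocks of the model and their invariants

COR-CM (cell `pub-hodgecm2`, stage 2 of the Hodge ladder), count-neutral KERNEL COMBINATORICS by the binder seat b23 (gen 44; claim
QUARTIC-INVERSION, HOME/INBOX.md l.12829).  Part XXI of the lane `Census/QuarticInversion*`, on top of parts I–XV, all BY NAME.  Bookkeeping
definitions with bodies (`blockSetoid`, `Block`, `blk`, `potB`, the class vector `cl`, the Boolean signatures `xor4`, `sigAll`, `sig`, `inv`) +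
theorems; `decide` only on closed Boolean identities over eight or nine Boolean literals (the invariance of the signatures under the three
motions), no certificate, no named fact, no geometry, no `sorry`.  `Interfaces.lean` (C1), every E term, B01, `Transposition/*`, `PortJoin/*`
untouched.
HONEST FRAMING: `HC_CM` is NOT proved, here or anywhere in the tree; nothing here is a period, a count of record or a headline.

CONTENT (`|B|` odd, square class `ζ`).
* §1 **The blocks of the model**: the classes of labels under the motions `twH₄ g`, `twY ζ`, `twT` (reachability = chains of motions, an
  equivalence since every motion is undone by a chain); the potential of a block.
* §2 **Block invariants**: the potential, and the Boolean signature `sig ζ Θ` = (parity of the halves, the `ζ = 0` constant invariant,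
  and three class-weighted relative-half invariants `W, X, V`) — each preserved by every motion (`sig_twH₄`, `sig_twY`, `sig_twT`), hence
  constant on blocks (`inv_eq_of_blk_eq`).  Part XXII uses them to exhibit ten (`ζ = 1`) resp. twelve (`ζ = 0`) residual blocks.  All [folklore].

## References
* [Pohlmann1968] H. Pohlmann, Algebraic cycles on abelian varieties of complex multiplication type, Ann. of Math. 88 (1968), Thm 1.
-/

namespace Summit.HodgeConjecture.CorCM.Census.QuarticInversion

open Finset
open Summit.HodgeConjecture.CorCM.Census.OddSliceFacesModel
open Summit.HodgeConjecture.CorCM.Census.OddSliceFacesSquares (clsTy clsTy_tw)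
open Summit.HodgeConjecture.CorCM.Census.DicyclicTwist (rev clsTy_rev)
open Summit.HodgeConjecture.CorCM.Census.EvenSliceFacesDescent (clsTy_add_one)

noncomputable section

variable (A : Type) [AddCommGroup A] [Fintype A] [DecidableEq A] (ζ : ZMod 2)

/-! ## §1 The blocks of the model -/

omit [Fintype A] [DecidableEq A] in
/-- Every motion is undone by a chain of motions. [folklore] -/
theorem step_rev {Θ Θ' : Ty₄ A}
    (h : (∃ g : ZMod 2 × A, Θ' = twH₄ A g Θ) ∨ Θ' = twY A ζ Θ ∨ Θ' = twT A Θ) :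
    Relation.ReflTransGen (fun Θ₁ Θ₂ : Ty₄ A => (∃ g : ZMod 2 × A, Θ₂ = twH₄ A g Θ₁) ∨ Θ₂ = twY A ζ Θ₁ ∨ Θ₂ = twT A Θ₁) Θ' Θ := by
  rcases h with ⟨g, rfl⟩ | rfl | rfl
  · exact Relation.ReflTransGen.single (Or.inl ⟨-g, by rw [twH₄_twH₄, add_neg_cancel, twH₄_zero]⟩)
  · refine Relation.ReflTransGen.tail (Relation.ReflTransGen.single (Or.inr (Or.inl rfl))) (Or.inl ⟨-(ζ, 0), ?_⟩)
    rw [twY_twY, twH₄_twH₄, add_neg_cancel, twH₄_zero]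
  · refine Relation.ReflTransGen.tail (Relation.ReflTransGen.single (Or.inr (Or.inr rfl))) (Or.inl ⟨-(1, 0), ?_⟩)
    rw [twT_twT, twH₄_twH₄, add_neg_cancel, twH₄_zero]

/-- **The block relation**: reachability by a chain of motions (an equivalence). [folklore] -/
def blockSetoid : Setoid (Ty₄ A) where
  r := Relation.ReflTransGen (fun Θ₁ Θ₂ : Ty₄ A => (∃ g : ZMod 2 × A, Θ₂ = twH₄ A g Θ₁) ∨ Θ₂ = twY A ζ Θ₁ ∨ Θ₂ = twT A Θ₁)
  iseqv := by
    refine ⟨fun _ => Relation.ReflTransGen.refl, fun h => ?_, fun h₁ h₂ => h₁.trans h₂⟩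
    induction h with
    | refl => exact Relation.ReflTransGen.refl
    | tail _ hs ih => exact (step_rev A ζ hs).trans ih

/-- **The blocks**: the orbits of `G_ζ(B)` on the labels of the model. [folklore] -/
def Block : Type := Quotient (blockSetoid A ζ)

/-- The blocks form a finite type. [folklore] -/
noncomputable instance : Fintype (Block A ζ) := by
  classical exact Quotient.fintype (blockSetoid A ζ)

/-- Equality of blocks is decidable (classically). [folklore] -/
noncomputable instance : DecidableEq (Block A ζ) := Classical.decEq _

/-- The block of a label. [folklore] -/
def blk (Θ : Ty₄ A) : Block A ζ := Quotient.mk (blockSetoid A ζ) Θ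

omit [Fintype A] [DecidableEq A] in
/-- Two labels have the same block iff a chain of motions joins them. [folklore] -/
theorem blk_eq_blk_iff (Θ Θ' : Ty₄ A) : blk A ζ Θ = blk A ζ Θ' ↔
    Relation.ReflTransGen (fun Θ₁ Θ₂ : Ty₄ A => (∃ g : ZMod 2 × A, Θ₂ = twH₄ A g Θ₁) ∨ Θ₂ = twY A ζ Θ₁ ∨ Θ₂ = twT A Θ₁) Θ Θ' :=
  Quotient.eq (r := blockSetoid A ζ)

omit [Fintype A] [DecidableEq A] in
/-- Motions do not change the block. [folklore] -/
theorem blk_twH₄ (g : ZMod 2 × A) (Θ : Ty₄ A) : blk A ζ (twH₄ A g Θ) = blk A ζ Θ :=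
  ((blk_eq_blk_iff A ζ _ _).mpr (Relation.ReflTransGen.single (Or.inl ⟨g, rfl⟩))).symm

omit [Fintype A] [DecidableEq A] in
/-- `y` does not change the block. [folklore] -/
theorem blk_twY (Θ : Ty₄ A) : blk A ζ (twY A ζ Θ) = blk A ζ Θ :=
  ((blk_eq_blk_iff A ζ _ _).mpr (Relation.ReflTransGen.single (Or.inr (Or.inl rfl)))).symm

omit [Fintype A] [DecidableEq A] in
/-- `t` does not change the block. [folklore] -/
theorem blk_twT (Θ : Ty₄ A) : blk A ζ (twT A Θ) = blk A ζ Θ :=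
  ((blk_eq_blk_iff A ζ _ _).mpr (Relation.ReflTransGen.single (Or.inr (Or.inr rfl)))).symm

omit [DecidableEq A] in
/-- **The potential is a block invariant.** [folklore] -/
theorem pot₄_eq_of_reach {Θ Θ' : Ty₄ A}
    (h : Relation.ReflTransGen (fun Θ₁ Θ₂ : Ty₄ A => (∃ g : ZMod 2 × A, Θ₂ = twH₄ A g Θ₁) ∨ Θ₂ = twY A ζ Θ₁ ∨ Θ₂ = twT A Θ₁) Θ Θ') :
    pot₄ A Θ = pot₄ A Θ' := by
  induction h with
  | refl => rfl
  | tail _ hs ih =>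
    rw [ih]
    rcases hs with ⟨g, rfl⟩ | rfl | rfl
    · exact (pot₄_twH₄ A g _).symm
    · exact (pot₄_twY A ζ _).symm
    · exact (pot₄_twT A _).symm

/-- The potential of a block. [folklore] -/
def potB (B : Block A ζ) : ℕ := Quotient.liftOn B (pot₄ A) fun _ _ h => pot₄_eq_of_reach A ζ h

omit [DecidableEq A] in
/-- `potB (blk Θ) = pot₄ Θ`. [folklore] -/
@[simp] theorem potB_blk (Θ : Ty₄ A) : potB A ζ (blk A ζ Θ) = pot₄ A Θ := rfl

/-! ## §2 The Boolean signature of a label and its invariance -/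

/-- XOR over the four coordinates. [folklore] -/
def xor4 (f : Fin 4 → Bool) : Bool := xor (xor (xor (f 0) (f 1)) (f 2)) (f 3)

/-- **The signature** of a (class vector, half vector) pair: parity of the halves; the `ζ = 0` constant invariant; and the class-weighted
relative halves `W = ⊕_n c_n·(h_n ⊻ h_{σT n} ⊻ [n ≥ 2])`, `X = ⊕_n c_n·(h_n ⊻ h_{σTσY n} ⊻ bY ζ n)`, `V = ⊕_n c_n·(h_{σY n} ⊻ h_{σT n} ⊻ bY ζ n)`.
[folklore] -/
def sigAll (ζ : ZMod 2) (c h : Fin 4 → Bool) : Bool × Bool × Bool × Bool × Bool :=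
  (xor4 h,
   decide (ζ = 0) && xor (xor (h 0) (h 3)) (xor4 h && xor (h 1) (h 3)),
   xor4 fun n => c n && xor (xor (h n) (h (σT n))) (decide (2 ≤ (n : ℕ))),
   xor4 fun n => c n && xor (xor (h n) (h (σT (σY n)))) (bY ζ n),
   xor4 fun n => c n && xor (xor (h (σY n)) (h (σT n))) (bY ζ n))

/-- Boolean statements about two patterns are checked on literal patterns. [folklore] -/
theorem pat₂_ind {P : (Fin 4 → Bool) → (Fin 4 → Bool) → Prop}
    (hP : ∀ c0 c1 c2 c3 h0 h1 h2 h3 : Bool, P ![c0, c1, c2, c3] ![h0, h1, h2, h3]) (c h : Fin 4 → Bool) : P c h := by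
  have ec : c = ![c 0, c 1, c 2, c 3] := by funext n; fin_cases n <;> rfl
  have eh : h = ![h 0, h 1, h 2, h 3] := by funext n; fin_cases n <;> rfl
  rw [ec, eh]; exact hP _ _ _ _ _ _ _ _

/-- **The signature is blind to a global flip of the halves** (`c` and the `H₀`-motions with `e = 1`). [folklore] -/
theorem sigAll_flip (ζ : ZMod 2) (c h : Fin 4 → Bool) (b : Bool) : sigAll ζ c (fun n => xor (h n) b) = sigAll ζ c h := by
  have h01 : ∀ z : ZMod 2, z = 0 ∨ z = 1 := by decide
  rcases h01 ζ with rfl | rfl <;> cases b <;>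
    exact pat₂_ind (P := fun c h => sigAll _ c (fun n => xor (h n) _) = sigAll _ c h) (by decide) c h

/-- **The signature is blind to the motion of `y`.** [folklore] -/
theorem sigAll_Y (ζ : ZMod 2) (c h : Fin 4 → Bool) :
    sigAll ζ (fun n => c (σY n)) (fun n => xor (h (σY n)) (bY ζ n)) = sigAll ζ c h := by
  have h01 : ∀ z : ZMod 2, z = 0 ∨ z = 1 := by decide
  rcases h01 ζ with rfl | rfl <;>
    exact pat₂_ind (P := fun c h => sigAll _ (fun n => c (σY n)) (fun n => xor (h (σY n)) (bY _ n)) = sigAll _ c h) (by decide) c h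

/-- **The signature is blind to the motion of `t`.** [folklore] -/
theorem sigAll_T (ζ : ZMod 2) (c h : Fin 4 → Bool) :
    sigAll ζ (fun n => c (σT n)) (fun n => xor (h (σT n)) (bT n)) = sigAll ζ c h := by
  have h01 : ∀ z : ZMod 2, z = 0 ∨ z = 1 := by decide
  rcases h01 ζ with rfl | rfl <;>
    exact pat₂_ind (P := fun c h => sigAll _ (fun n => c (σT n)) (fun n => xor (h (σT n)) (bT n)) = sigAll _ c h) (by decide) c h

/-- **The class vector** of a label: which coordinates are atoms (class `1`). [folklore] -/
def cl (Θ : Ty₄ A) : Fin 4 → Bool := fun n => decide (clsTy A (coord A n Θ) = 1)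

/-- **The signature of a label.** [folklore] -/
def sig (Θ : Ty₄ A) : Bool × Bool × Bool × Bool × Bool := sigAll ζ (cl A Θ) (hv A Θ)

/-- **The invariant vector** of a label: potential and signature. [folklore] -/
def inv (Θ : Ty₄ A) : ℕ × (Bool × Bool × Bool × Bool × Bool) := (pot₄ A Θ, sig A ζ Θ)

omit [DecidableEq A] in
/-- Halves under `H₀`. [folklore] -/
theorem hv_twH₄ (hA : Odd (Fintype.card A)) (g : ZMod 2 × A) (Θ : Ty₄ A) :
    hv A (twH₄ A g Θ) = fun n => xor (hv A Θ n) (decide (g.1 = 1)) :=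
  funext fun n => half_coord_twH₄ A hA g Θ n

omit [DecidableEq A] in
/-- Halves under `y`. [folklore] -/
theorem hv_twY (hA : Odd (Fintype.card A)) (Θ : Ty₄ A) : hv A (twY A ζ Θ) = fun n => xor (hv A Θ (σY n)) (bY ζ n) :=
  funext fun n => half_coord_twY A hA ζ Θ n

omit [AddCommGroup A] [DecidableEq A] in
/-- Halves under `t`. [folklore] -/
theorem hv_twT (hA : Odd (Fintype.card A)) (Θ : Ty₄ A) : hv A (twT A Θ) = fun n => xor (hv A Θ (σT n)) (bT n) :=
  funext fun n => half_coord_twT A hA Θ n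

omit [DecidableEq A] in
/-- Classes under `H₀`. [folklore] -/
theorem cl_twH₄ (g : ZMod 2 × A) (Θ : Ty₄ A) : cl A (twH₄ A g Θ) = cl A Θ := by
  funext n; simp only [cl, coord_twH₄, clsTy_tw]

omit [DecidableEq A] in
/-- Classes of the coordinates under `y`. [folklore] -/
theorem clsTy_coord_twY (Θ : Ty₄ A) (n : Fin 4) : clsTy A (coord A n (twY A ζ Θ)) = clsTy A (coord A (σY n) Θ) := by
  rw [coord_twY]
  cases bY ζ n
  · rw [show (if false = true then (1 : Ty A) else 0) = 0 from rfl, add_zero, clsTy_rev]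
  · rw [show (if true = true then (1 : Ty A) else 0) = 1 from rfl, clsTy_add_one, clsTy_rev]

omit [DecidableEq A] in
/-- Classes of the coordinates under `t`. [folklore] -/
theorem clsTy_coord_twT (Θ : Ty₄ A) (n : Fin 4) : clsTy A (coord A n (twT A Θ)) = clsTy A (coord A (σT n) Θ) := by
  rw [coord_twT]
  cases bT n
  · rw [show (if false = true then (1 : Ty A) else 0) = 0 from rfl, add_zero]
  · rw [show (if true = true then (1 : Ty A) else 0) = 1 from rfl, clsTy_add_one]

omit [DecidableEq A] in
/-- Classes under `y`. [folklore] -/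
theorem cl_twY (Θ : Ty₄ A) : cl A (twY A ζ Θ) = fun n => cl A Θ (σY n) := by
  funext n; unfold cl; rw [clsTy_coord_twY]

omit [DecidableEq A] in
/-- Classes under `t`. [folklore] -/
theorem cl_twT (Θ : Ty₄ A) : cl A (twT A Θ) = fun n => cl A Θ (σT n) := by
  funext n; unfold cl; rw [clsTy_coord_twT]

omit [DecidableEq A] in
/-- **The signature is preserved by `H₀`.** [folklore] -/
theorem sig_twH₄ (hA : Odd (Fintype.card A)) (g : ZMod 2 × A) (Θ : Ty₄ A) : sig A ζ (twH₄ A g Θ) = sig A ζ Θ := by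
  unfold sig; rw [hv_twH₄ A hA, cl_twH₄, sigAll_flip]

omit [DecidableEq A] in
/-- **The signature is preserved by `y`.** [folklore] -/
theorem sig_twY (hA : Odd (Fintype.card A)) (Θ : Ty₄ A) : sig A ζ (twY A ζ Θ) = sig A ζ Θ := by
  unfold sig; rw [hv_twY A ζ hA, cl_twY, sigAll_Y]

omit [DecidableEq A] in
/-- **The signature is preserved by `t`.** [folklore] -/
theorem sig_twT (hA : Odd (Fintype.card A)) (Θ : Ty₄ A) : sig A ζ (twT A Θ) = sig A ζ Θ := by
  unfold sig; rw [hv_twT A hA, cl_twT, sigAll_T]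

omit [DecidableEq A] in
/-- **The invariant vector is constant along chains of motions.** [folklore] -/
theorem inv_eq_of_reach (hA : Odd (Fintype.card A)) {Θ Θ' : Ty₄ A}
    (h : Relation.ReflTransGen (fun Θ₁ Θ₂ : Ty₄ A => (∃ g : ZMod 2 × A, Θ₂ = twH₄ A g Θ₁) ∨ Θ₂ = twY A ζ Θ₁ ∨ Θ₂ = twT A Θ₁) Θ Θ') :
    inv A ζ Θ = inv A ζ Θ' := by
  induction h with
  | refl => rfl
  | tail _ hs ih =>
    rw [ih]
    rcases hs with ⟨g, rfl⟩ | rfl | rfl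
    · unfold inv; rw [pot₄_twH₄, sig_twH₄ A ζ hA]
    · unfold inv; rw [pot₄_twY, sig_twY A ζ hA]
    · unfold inv; rw [pot₄_twT, sig_twT A ζ hA]

omit [DecidableEq A] in
/-- **Labels in the same block have the same invariant vector.** [folklore] -/
theorem inv_eq_of_blk_eq (hA : Odd (Fintype.card A)) {Θ Θ' : Ty₄ A} (h : blk A ζ Θ = blk A ζ Θ') : inv A ζ Θ = inv A ζ Θ' :=
  inv_eq_of_reach A ζ hA ((blk_eq_blk_iff A ζ Θ Θ').mp h)

end

end Summit.HodgeConjecture.CorCM.Census.QuarticInversion
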